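/-
Origin: expansion seat `prover-pub-hodgecm-mc-discharge-1-0`, handover #3 14:10Z md5 2469199ca0a4 (105 l.; NEW additive LIGHT PKG leaf (theta-3-g8 request 13:27:31Z/13:34:56Z): Model.satLevelOf V K := awayFromCM 3 L ι₁ V.Hm ⊓ cmSplitLevel L 3 V.Hm K : Subgroup ↥(adelicUnitaryGroup L V.Hm), Model.satLevelRegimeOf V hV K := its image under regimeEquiv, satLevelOf_eq / mem_satLevelOf_iff / satLevelOf_le_cmSplitLevel / satLevelOf_le_awayFromCM / satLevelOf_mono / mem_satLevelRegimeOf_of_mem / mem_satLevelRegimeOf_iff / satLevelRegimeOf_mono; imports HodgeCM.Automorphic.AdelicUnitaryModel + Model/Junction/TreeTwins + #1096 twin only — no EmbInstance, no pin, no E; KERNEL, 0 records) (`HOME/mc/pub-hodgecm-mc-discharge-1/pkg/HodgeCM/Model/Junction/LevelSaturation.lean`, md5 2469199c, 105 lines);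
landed by the gen-12 packager (p-g12) in gate run 36 as `HodgeCM/Model/Junction/LevelSaturation.lean` (verbatim).
-/
/-
Origin: DISCHARGE seat `prover-pub-hodgecm-mc-discharge-1-0` (unit pub-hodgecm-mc-discharge-1, ticket D-1′ of `HOME/BINDER-OWNERS.md`, row 14
`gen12` (J-Λ)/(J-sat)), 2026-08-19, on the pin owner's request (theta-3-g8 STATUS 13:27:31Z (1): «type `SatLevel` as a
`Subgroup ↥(adelicUnitaryGroup L V.Hm)`-valued function of the level in a file the pin `Model/ThetaSpaceInputPin` can import without
cycle»). NEW additive LIGHT PKG leaf `HodgeCM/Model/Junction/LevelSaturation.lean`: imports ONLY `HodgeCM.Automorphic.AdelicUnitaryModel`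
(`regimeEquiv`, `HermSpace3`), `Model/Junction/TreeTwins` (the `rfl` twins tree `adelicUnitaryGroup` = PKG) and the vendored tree twins
`Automorphic/UnitaryGroupArchSection` (period-1 kit t36 #1096) / `Automorphic/UnitaryGroupArchLatticeJunction` (installed); no `EmbInstance`,
no pin, no E file. KERNEL: two definitions (subgroups) + membership lemmas; 0 records; nothing cited.
-/
import Summits.HodgeConjecture.HodgeCM.Automorphic.AdelicUnitaryModel_2
import Summits.HodgeConjecture.HodgeCM.Model.Junction.TreeTwins
import Literature.NumberTheory.Automorphic.UnitaryGroupArchSection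

/-!
# The saturation subgroup of a finite level (J-sat / (Θ-sat-K) currency)

For a hermitian space `V : HermSpace3 L ι₁` and a finite level `K ≤ U(V)(𝔸_{L⁺,f})`:

* `Model.satLevelOf V K := awayFromCM 3 L ι₁ V.Hm ⊓ cmSplitLevel L 3 V.Hm K ≤ U(V)(𝔸_{L⁺})` — the elements of the open
  subgroup `M_K = U(V)(L ⊗ ℝ) × K` whose `ι₁`-archimedean component is trivial, i.e. the compact archimedean factors
  `Π_{w ≠ w(ι₁)} U(V)(L_w)` times `K` (tree `UnitaryGroupArchSection.awayFromCM`, `UnitaryGroupArchLatticeJunction.cmSplitLevel`);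
* `Model.satLevelRegimeOf V hV K` — its image in the regime model `↥(regimeSubgroup L V.Hm)` of `G_U(𝔸)` under `regimeEquiv`
  (the END-STATE quotient model's group, `HermSpace3.latticeModel_G`).

RIGHT-invariance of an adelic representative under `satLevelRegimeOf V hV K_Γ` is the saturation predicate `SatLevel` of the
(J-Λ) discharge `Model/Binders/Gen12ProjDischarge` and the pin's saturation index `KΓ` ((Θ-sat-K), theta-3): one name for both.
-/

set_option autoImplicit false

noncomputable section

open Literature.NumberTheory.Automorphic Literature.NumberTheory.Automorphic.UnitaryGroup
open NumberField

namespace HodgeCM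

namespace Model

variable {L : CMField} {ι₁ : L →+* ℂ} (V : HermSpace3 L ι₁)

/-- **The saturation subgroup of the finite level `K`**: `awayFromCM 3 L ι₁ V.Hm ⊓ cmSplitLevel L 3 V.Hm K ≤ U(V)(𝔸_{L⁺})` —
the compact archimedean factors away from `ι₁` times `K`. -/
def satLevelOf (K : Subgroup (finAdelic (↥(maximalRealSubfield L)) L (IsCMField.complexConj L) 3 V.Hm)) :
    Subgroup ↥(Literature.NumberTheory.Automorphic.adelicUnitaryGroup (L : Type) V.Hm) :=
  awayFromCM 3 (L : Type) ι₁ V.Hm ⊓ cmSplitLevel (L : Type) 3 V.Hm K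

/-- (Ported verbatim from the HodgeCMPerL package; no docstring in the source.) -/
theorem satLevelOf_eq (K : Subgroup (finAdelic (↥(maximalRealSubfield L)) L (IsCMField.complexConj L) 3 V.Hm)) :
    satLevelOf V K = awayFromCM 3 (L : Type) ι₁ V.Hm ⊓ cmSplitLevel (L : Type) 3 V.Hm K := rfl

/-- (Ported verbatim from the HodgeCMPerL package; no docstring in the source.) -/
theorem mem_satLevelOf_iff (K : Subgroup (finAdelic (↥(maximalRealSubfield L)) L (IsCMField.complexConj L) 3 V.Hm))
    (g : ↥(Literature.NumberTheory.Automorphic.adelicUnitaryGroup (L : Type) V.Hm)) :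
    g ∈ satLevelOf V K ↔ g ∈ awayFromCM 3 (L : Type) ι₁ V.Hm ∧ g ∈ cmSplitLevel (L : Type) 3 V.Hm K :=
  Subgroup.mem_inf

/-- `satLevelOf V K ≤ M_K`. -/
theorem satLevelOf_le_cmSplitLevel (K : Subgroup (finAdelic (↥(maximalRealSubfield L)) L (IsCMField.complexConj L) 3 V.Hm)) :
    satLevelOf V K ≤ cmSplitLevel (L : Type) 3 V.Hm K :=
  inf_le_right

/-- `satLevelOf V K ≤ awayFromCM`. -/
theorem satLevelOf_le_awayFromCM (K : Subgroup (finAdelic (↥(maximalRealSubfield L)) L (IsCMField.complexConj L) 3 V.Hm)) :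
    satLevelOf V K ≤ awayFromCM 3 (L : Type) ι₁ V.Hm :=
  inf_le_left

/-- **Monotonicity in the level** (`K' ≤ K ⇒ satLevelOf V K' ≤ satLevelOf V K`): the input of the pin's `KΓ_mono`. -/
theorem satLevelOf_mono {K K' : Subgroup (finAdelic (↥(maximalRealSubfield L)) L (IsCMField.complexConj L) 3 V.Hm)}
    (h : K' ≤ K) : satLevelOf V K' ≤ satLevelOf V K :=
  inf_le_inf_left _ fun g hg =>
    (mem_cmSplitLevel_iff (L : Type) 3 V.Hm K g).2 (h ((mem_cmSplitLevel_iff (L : Type) 3 V.Hm K' g).1 hg))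

/-- **The saturation subgroup read in the regime model** `↥(regimeSubgroup L V.Hm)` of `G_U(𝔸)` (the END-STATE quotient
model's group): the image of `satLevelOf V K` under `regimeEquiv` (anisotropic regime `hV`). -/
def satLevelRegimeOf (hV : IsAnisotropic L V.Hm)
    (K : Subgroup (finAdelic (↥(maximalRealSubfield L)) L (IsCMField.complexConj L) 3 V.Hm)) :
    Subgroup ↥(HodgeCM.Adelic.regimeSubgroup L V.Hm) :=
  (satLevelOf V K).map (HodgeCM.Adelic.regimeEquiv L V.Hm hV).toMonoidHom

/-- (Ported verbatim from the HodgeCMPerL package; no docstring in the source.) -/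
theorem mem_satLevelRegimeOf_of_mem (hV : IsAnisotropic L V.Hm)
    (K : Subgroup (finAdelic (↥(maximalRealSubfield L)) L (IsCMField.complexConj L) 3 V.Hm))
    {g : ↥(Literature.NumberTheory.Automorphic.adelicUnitaryGroup (L : Type) V.Hm)} (hg : g ∈ satLevelOf V K) :
    HodgeCM.Adelic.regimeEquiv L V.Hm hV g ∈ satLevelRegimeOf V hV K :=
  Subgroup.mem_map_of_mem (HodgeCM.Adelic.regimeEquiv L V.Hm hV).toMonoidHom hg

/-- (Ported verbatim from the HodgeCMPerL package; no docstring in the source.) -/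
theorem mem_satLevelRegimeOf_iff (hV : IsAnisotropic L V.Hm)
    (K : Subgroup (finAdelic (↥(maximalRealSubfield L)) L (IsCMField.complexConj L) 3 V.Hm))
    (k : ↥(HodgeCM.Adelic.regimeSubgroup L V.Hm)) :
    k ∈ satLevelRegimeOf V hV K ↔ (HodgeCM.Adelic.regimeEquiv L V.Hm hV).symm k ∈ satLevelOf V K := by
  constructor
  · rintro ⟨g, hg, rfl⟩
    exact hg
  · intro hk
    exact ⟨_, hk, (HodgeCM.Adelic.regimeEquiv L V.Hm hV).apply_symm_apply k⟩

/-- Monotonicity in the level, regime model. -/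
theorem satLevelRegimeOf_mono (hV : IsAnisotropic L V.Hm)
    {K K' : Subgroup (finAdelic (↥(maximalRealSubfield L)) L (IsCMField.complexConj L) 3 V.Hm)} (h : K' ≤ K) :
    satLevelRegimeOf V hV K' ≤ satLevelRegimeOf V hV K :=
  Subgroup.map_mono (satLevelOf_mono V h)

end Model

end HodgeCM

end
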